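import Literature.RepresentationTheory.Semisimple.SmoothCompactLocallyFinite
import HarnessLib

/-!
# A semisimple representation without `ν`-eigenvectors has no `ν`-eigenfunctionals (the vanishing step of the compact-doubling
# argument for `rankOne_theta_lines_disjoint`)

Topic `RepresentationTheory/Semisimple`; theorems only (no definition, no named fact).  Elementary, over `ℂ` (any `ν : U → ℂ`):

* `eigenfunctional_eq_zero_of_isSemisimpleRepresentation` — if `π : U → GL(Ω)` is SEMISIMPLE (Mathlib
  `Representation.IsSemisimpleRepresentation`: the `ℂ[U]`-module `Ω` is a sum of simple submodules) and no non-zero vector is a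
  `ν`-eigenvector (`π u v = ν u • v` for all `u` forces `v = 0`), then every linear functional `Λ` with `Λ (π u x) = ν u · Λ x` is
  zero.  Proof: on a simple submodule `S` the kernel of `Λ|_S` is `U`-stable, so `Λ|_S = 0` or `Λ|_S` is injective; in the
  latter case `S` is a line spanned by a `ν`-eigenvector — excluded; and the simple submodules span `Ω` (Bourbaki, Algèbre VIII
  § 4 n° 1–3: a semisimple module is the sum of its simple submodules; a non-zero linear form injective on a simple submodule
  makes it one-dimensional).
* `eigenfunctional_eq_zero_of_commute_compact` — the form used by the doubling see-saw: `Ω` carries a SMOOTH UNITARY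
  representation `π_C` of a COMPACT group `C` commuting with `π_U`; if `π_U` restricted to (the underlying subspace of) every
  `π_C`-isotypic component is semisimple and `Ω` has no `ν`-eigenvector under `π_U`, then `Ω` has no `ν`-eigenfunctional under
  `π_U` (the isotypic components are `π_U`-stable and span `Ω`: `SmoothCompactLocallyFinite`).

Consumer (cell hodgecm-mathlib, row IV-4(c1) `rankOne_theta_lines_disjoint`, plan «compact (anisotropic) doubling», director g1
2026-08-28T03:03Z): `Ω = 𝒮(F_v^{3 ⊕ 3})` the doubled Schrödinger model, `π_C` the Weil action of the COMPACT `U(𝕎₂)(F_v)`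
(`𝕎₂ = W_{ε₁} ⊕ (−W_{ε₂})` anisotropic for lines in different classes, `RankOneThetaLinesDoubledPlaneAnisotropic`), `π_U` the
diagonal `u ↦ (ι_{δ₁} u, ι_{δ₂} u)` action of `U(V)(F_v)`, `ν` a character from the two splittings, `Λ` the functional built from a
putative isomorphism `Θ_{s₁}(χ₁) ≅ Θ_{s₂}(χ₂)`; the hypotheses are the plan's pieces (β)+(γ) (semisimplicity of `π_U` on the
isotypic components: admissible + unitary) and (δ) (no `U(V)`-eigenvectors in the unitary Weil representation).  Nothing about Weil
representations is in this file; all inputs are explicit binders.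

## References
* [BourbakiAlgebreVIII2012] N. Bourbaki, *Algèbre* VIII § 4 n° 1–3 (semisimple modules: sum of simple submodules; Schur).
* [Bump1997] D. Bump, *Automorphic Forms and Representations*, Prop. 4.2.5 (via `SmoothCompactLocallyFinite`).
-/

noncomputable section

open scoped InnerProductSpace MonoidAlgebra

namespace Literature.RepresentationTheory.Semisimple

/-! ## Semisimple + no `ν`-eigenvector ⇒ no `ν`-eigenfunctional -/

section Semisimple

variable {U : Type*} [Group U] {Ω : Type*} [AddCommGroup Ω] [Module ℂ Ω] (π : Representation ℂ U Ω)

/-- The vectors killed by a `ν`-eigenfunctional `Λ` form a `ℂ[U]`-submodule of `π.asModule` (plumbing: `Λ (π u x) = ν u · Λ x`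
vanishes with `Λ x`). [cite: BourbakiAlgebreVIII2012, VIII §4 n°1] -/
theorem exists_submodule_ker_of_eigenfunctional (ν : U → ℂ) (Λ : Ω →ₗ[ℂ] ℂ)
    (hΛ : ∀ (u : U) (x : Ω), Λ (π u x) = ν u * Λ x) :
    ∃ K : Submodule ℂ[U] π.asModule, ∀ x : π.asModule, x ∈ K ↔ Λ (π.asModuleEquiv x) = 0 := by
  refine ⟨{ carrier := {x | Λ (π.asModuleEquiv x) = 0}
            add_mem' := fun {x y} hx hy => by
              simp only [Set.mem_setOf_eq, map_add] at hx hy ⊢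
              rw [hx, hy, add_zero]
            zero_mem' := by simp
            smul_mem' := fun a x hx => ?_ }, fun x => Iff.rfl⟩
  simp only [Set.mem_setOf_eq] at hx ⊢
  induction a using MonoidAlgebra.induction_on with
  | hM u =>
    obtain ⟨w, rfl⟩ : ∃ w : Ω, π.asModuleEquiv.symm w = x := ⟨π.asModuleEquiv x, by simp⟩
    rw [LinearEquiv.apply_symm_apply] at hx
    rw [← Representation.asModuleEquiv_symm_map_rho, LinearEquiv.apply_symm_apply, hΛ, hx, mul_zero]
  | hadd a b ha hb => rw [add_smul, map_add, map_add, ha, hb, add_zero]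
  | hsmul r a ha => rw [smul_assoc, map_smul, map_smul, ha, smul_zero]

/-- **A semisimple representation with no `ν`-eigenvector has no `ν`-eigenfunctional.**  Let `π : U → GL(Ω)` be semisimple
(`Representation.IsSemisimpleRepresentation`), `ν : U → ℂ`, and suppose `π u v = ν u • v` for all `u` forces `v = 0`.  Then every
`ℂ`-linear `Λ : Ω → ℂ` with `Λ (π u x) = ν u · Λ x` vanishes: on each simple `ℂ[U]`-submodule `S` the kernel of `Λ|_S` is a
submodule, so `Λ|_S = 0` — else `Λ|_S` is injective, `S` is the line through a `ν`-eigenvector; and the simple submodules span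
(Mathlib `IsSemisimpleModule.sSup_simples_eq_top`).  Bourbaki, Algèbre VIII § 4 n° 1–3. [cite: BourbakiAlgebreVIII2012, VIII §4 n°3] -/
theorem eigenfunctional_eq_zero_of_isSemisimpleRepresentation (hss : π.IsSemisimpleRepresentation) (ν : U → ℂ)
    (hδ : ∀ v : Ω, (∀ u : U, π u v = ν u • v) → v = 0) (Λ : Ω →ₗ[ℂ] ℂ)
    (hΛ : ∀ (u : U) (x : Ω), Λ (π u x) = ν u * Λ x) : Λ = 0 := by
  haveI : IsSemisimpleModule ℂ[U] π.asModule :=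
    (Representation.isSemisimpleRepresentation_iff_isSemisimpleModule_asModule π).mp hss
  obtain ⟨K, hK⟩ := exists_submodule_ker_of_eigenfunctional π ν Λ hΛ
  -- `Λ` vanishes on every simple submodule
  have hS : ∀ S : Submodule ℂ[U] π.asModule, IsSimpleModule ℂ[U] S → S ≤ K := by
    intro S hSimple
    -- `S ⊓ K` is `⊥` or `S`
    rcases (isSimpleModule_iff_isAtom.mp hSimple).le_iff.mp (inf_le_left : S ⊓ K ≤ S) with hbot | htop
    · -- `Λ` is injective on `S`: `S` is a line of `ν`-eigenvectors, excluded
      exfalso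
      haveI := hSimple
      haveI : Nontrivial S := IsSimpleModule.nontrivial ℂ[U] S
      obtain ⟨⟨s, hs⟩, hs0⟩ := exists_ne (0 : S)
      have hs0' : s ≠ 0 := fun h => hs0 (Subtype.ext h)
      have hinj : ∀ x ∈ S, Λ (π.asModuleEquiv x) = 0 → x = 0 := fun x hx h0 =>
        (Submodule.mem_bot ℂ[U]).1 (hbot ▸ Submodule.mem_inf.mpr ⟨hx, (hK x).2 h0⟩)
      have hΛs : Λ (π.asModuleEquiv s) ≠ 0 := fun h => hs0' (hinj s hs h)
      -- every `π u s` is the multiple `ν u • s`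
      have heig : ∀ u : U, π u (π.asModuleEquiv s) = ν u • π.asModuleEquiv s := by
        intro u
        have hmem : MonoidAlgebra.of ℂ U u • s - (ν u) • s ∈ S :=
          S.sub_mem (S.smul_mem _ hs) (by
            rw [← algebraMap_smul (MonoidAlgebra ℂ U) (ν u) s]
            exact S.smul_mem _ hs)
        have hzero : Λ (π.asModuleEquiv (MonoidAlgebra.of ℂ U u • s - (ν u) • s)) = 0 := by
          rw [map_sub, map_sub, Representation.asModuleEquiv_map_smul, Representation.asAlgebraHom_of, hΛ,
            LinearEquiv.map_smul, LinearMap.map_smul, smul_eq_mul, sub_self]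
        have := hinj _ hmem hzero
        rw [sub_eq_zero] at this
        have h2 := congrArg π.asModuleEquiv this
        rw [Representation.asModuleEquiv_map_smul, Representation.asAlgebraHom_of, LinearEquiv.map_smul] at h2
        exact h2
      exact hΛs (by rw [hδ _ heig, map_zero])
    · exact inf_eq_left.mp htop
  -- hence on their supremum, which is everything
  apply LinearMap.ext
  intro v
  have hv : π.asModuleEquiv.symm v ∈ sSup {S : Submodule ℂ[U] π.asModule | IsSimpleModule ℂ[U] S} := by
    rw [IsSemisimpleModule.sSup_simples_eq_top]
    exact Submodule.mem_top
  have hvK : π.asModuleEquiv.symm v ∈ K := (sSup_le fun S hS' => hS S hS') hv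
  have := (hK _).1 hvK
  rw [LinearEquiv.apply_symm_apply] at this
  rw [this, LinearMap.zero_apply]

end Semisimple

/-! ## The see-saw form: a commuting smooth unitary compact action, semisimplicity on its isotypic components -/

section Compact

variable {C U : Type*} [Group C] [TopologicalSpace C] [IsTopologicalGroup C] [CompactSpace C] [Group U]
  {Ω : Type*} [NormedAddCommGroup Ω] [InnerProductSpace ℂ Ω] (πC : Representation ℂ C Ω) (πU : Representation ℂ U Ω)

omit [TopologicalSpace C] [IsTopologicalGroup C] [CompactSpace C] [NormedAddCommGroup Ω] [InnerProductSpace ℂ Ω] in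
/-- The underlying subspace of a `π_C`-isotypic component is stable under every operator commuting with `π_C` — in particular
under a commuting representation `π_U` — so `π_U` restricts to a subrepresentation there (plumbing over
`mem_toSubspace_isotypicComponent_of_commute`). [cite: BourbakiAlgebreVIII2012, VIII §4 n°6 Prop. 5 a)] -/
theorem exists_subrepresentation_isotypicComponent {Ω : Type*} [AddCommGroup Ω] [Module ℂ Ω]
    (πC : Representation ℂ C Ω) (πU : Representation ℂ U Ω)
    (hcomm : ∀ (c : C) (u : U), πC c ∘ₗ πU u = πU u ∘ₗ πC c)
    {c : Submodule ℂ[C] πC.asModule} (hc : c ∈ isotypicComponents ℂ[C] πC.asModule) :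
    ∃ S : Subrepresentation πU, S.toSubmodule = toSubspace πC c :=
  ⟨{ toSubmodule := toSubspace πC c
     apply_mem_toSubmodule := fun u _ hv =>
       mem_toSubspace_isotypicComponent_of_commute (πU u) (fun g => (hcomm g u).symm) hc hv }, rfl⟩

/-- **No `ν`-eigenfunctional on a space with a commuting compact action** (the vanishing step of the compact doubling see-saw).
Let `π_C` be a SMOOTH representation of a COMPACT group `C` by UNITARY operators on a complex inner product space `Ω`, commuting
with a representation `π_U` of a group `U`; suppose that `π_U` restricted to the underlying subspace of every `π_C`-isotypic
component is SEMISIMPLE (e.g. admissible and unitary there) and that `Ω` has no non-zero `ν`-eigenvector under `π_U`.  Then every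
linear functional `Λ` on `Ω` with `Λ (π_U u x) = ν u · Λ x` is zero: by `eigenfunctional_eq_zero_of_isSemisimpleRepresentation` on
each isotypic component, and the isotypic components span (`eq_zero_of_forall_isotypicComponents`).
[cite: BourbakiAlgebreVIII2012, VIII §4 n°3] [cite: Bump1997, Proposition 4.2.5] -/
theorem eigenfunctional_eq_zero_of_commute_compact (hCu : ∀ c v w, ⟪πC c v, πC c w⟫_ℂ = ⟪v, w⟫_ℂ) (hCs : πC.IsSmooth)
    (hcomm : ∀ (c : C) (u : U), πC c ∘ₗ πU u = πU u ∘ₗ πC c)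
    (hss : ∀ S : Subrepresentation πU, (S.toSubmodule : Submodule ℂ Ω) ∈
      (fun c => toSubspace πC c) '' isotypicComponents ℂ[C] πC.asModule → S.toRepresentation.IsSemisimpleRepresentation)
    (ν : U → ℂ) (hδ : ∀ v : Ω, (∀ u : U, πU u v = ν u • v) → v = 0) (Λ : Ω →ₗ[ℂ] ℂ)
    (hΛ : ∀ (u : U) (x : Ω), Λ (πU u x) = ν u * Λ x) : Λ = 0 := by
  refine eq_zero_of_forall_isotypicComponents hCu hCs Λ fun c hc v hv => ?_
  obtain ⟨S, hS⟩ := exists_subrepresentation_isotypicComponent πC πU hcomm hc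
  -- restrict everything to the subrepresentation `S`
  have hssS : S.toRepresentation.IsSemisimpleRepresentation := hss S ⟨c, hc, hS.symm⟩
  have hδS : ∀ w : S.toSubmodule, (∀ u : U, S.toRepresentation u w = ν u • w) → w = 0 := by
    intro w hw
    apply Subtype.ext
    exact hδ w fun u => congrArg Subtype.val (hw u)
  have hΛS : ∀ (u : U) (x : S.toSubmodule), (Λ ∘ₗ S.toSubmodule.subtype) (S.toRepresentation u x) =
      ν u * (Λ ∘ₗ S.toSubmodule.subtype) x := fun u x => hΛ u x
  have h0 := eigenfunctional_eq_zero_of_isSemisimpleRepresentation S.toRepresentation hssS ν hδS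
    (Λ ∘ₗ S.toSubmodule.subtype) hΛS
  have hvS : v ∈ S.toSubmodule := hS ▸ hv
  have := LinearMap.congr_fun h0 ⟨v, hvS⟩
  simpa using this

end Compact

end Literature.RepresentationTheory.Semisimple

end
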